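import Summits.QuantumFields.YangMills.Theorems.RationalShortRootRigidityPlanarFrame
import Summits.QuantumFields.YangMills.Theorems.RationalShortRootRigidityPlanarRestriction
import Summits.QuantumFields.YangMills.Theorems.RationalShortRootRigidityPlanarSupport
import Summits.QuantumFields.YangMills.Theorems.RationalShortRootRigidityTopFormRoots
import Summits.QuantumFields.YangMills.Theorems.RationalShortRootRigidityTopFormSymmetry
import Summits.QuantumFields.YangMills.Theorems.RationalShortRootRigidityMobiusTopForm
import Summits.QuantumFields.YangMills.Theorems.RationalShortRootRigidityNoU3Lemma
import Summits.QuantumFields.YangMills.Theorems.RationalShortRootRigidityQuarticF4Radial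
import HarnessLib

/-!
# `RationalShortRootRigidity` — Step 2 of the paper proof (`stub_planar`), assembled: the 60° planar lemma

Free-standing theorem INSIDE the paper proof of crux `stmt-QuantumFields-23124` (`F4SubCurvatureDoor.RationalShortRootRigidity`,
LINE g15-A of planner ym-idea-3).  It is the birth skeleton's `stub_planar` (HOME l15/RationalShortRootRigidity-birth.lean)

  `∀ D₀, IsB4Inv D₀ → IsHalfInv D₀ → FullDeg D₀ → WickAlong e0 D₀ → WickAlong half D₀ → PlaneRotInv D₀`

with the skeleton's definitions (`IsB4Inv`, `IsHalfInv`, `FullDeg`, `WickAlong`, `e0`, `half`, `rotPlane`, `PlaneRotInv`) UNFOLDED verbatim,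
so that a registered stub closes by `exact stub_planar`.  Assembly per the owner's plan HOME l15/STUB-PLAN-Planar.md from the tree lemmas:
`planar_restriction_dihedral` / `planeRotInv_of_planar_radial` (p670833), `eval_planarRestriction` / `totalDegree_planarRestriction_le` /
`coeff_top_planarRestriction` / `planarRestriction_roots_imaginary` (p671737), `topForm_roots_imaginary` (p671114), `homogeneousComponent_even` /
`homogeneousComponent_rot` (p671240), `mobiusTopForm` (p665007), `support_bound_of_topForm` (p671907), `noU3Lemma` (p668537) and
`coeff_eq_zero_of_odd` (p670117; evenness of `deg D₀`).  The hypothesis `WickAlong half` is not used (it follows from the others).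

Mathlib + the tree; THEOREMS ONLY; no named facts; no `sorry`; default heartbeats.  HONEST LABEL: this closes Step 2 of the paper proof as a
free-standing theorem; the crux 23124 itself (Steps 1 and 4 assemblies, and the skeleton registration), the route `F4SubCurvatureDoor`, its rung
and the Yang–Mills mass gap are NOT proved here.  Free-hands seat `ym-line-frs-p2` g10, `--supports stmt-QuantumFields-23124`.
-/

set_option autoImplicit false

namespace Summit.QuantumFields.YangMills.Theorems.RationalShortRootRigidity

open scoped BigOperators

/-- A Chevalley polynomial `c ∈ ℝ[U,V]` as an explicit finite sum over `ℕ × ℕ` with non-zero coefficients. [folklore] -/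
theorem exists_pairSum (c : MvPolynomial (Fin 2) ℝ) :
    ∃ (S : Finset (ℕ × ℕ)) (cf : ℕ × ℕ → ℝ), (∀ ij ∈ S, cf ij ≠ 0) ∧
      (∀ w : Fin 2 → ℝ, MvPolynomial.eval w c = ∑ ij ∈ S, cf ij * w 0 ^ ij.1 * w 1 ^ ij.2) ∧
      (∀ w : Fin 2 → ℂ, MvPolynomial.aeval w c = ∑ ij ∈ S, (cf ij : ℂ) * w 0 ^ ij.1 * w 1 ^ ij.2) := by
  classical
  set e : (Fin 2 →₀ ℕ) → ℕ × ℕ := fun d => (d 0, d 1) with he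
  have heinj : Function.Injective e := by
    intro d d' h
    simp only [he, Prod.mk.injEq] at h
    ext i; fin_cases i
    · exact h.1
    · exact h.2
  have hsingle : ∀ d : Fin 2 →₀ ℕ, Finsupp.single 0 (d 0) + Finsupp.single 1 (d 1) = d := by
    intro d; ext i; fin_cases i <;> simp
  refine ⟨c.support.image e, fun ij => MvPolynomial.coeff (Finsupp.single 0 ij.1 + Finsupp.single 1 ij.2) c, ?_, ?_, ?_⟩
  · intro ij hij
    obtain ⟨d, hd, rfl⟩ := Finset.mem_image.1 hij
    simp only [he, hsingle]
    exact MvPolynomial.mem_support_iff.1 hd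
  · intro w
    rw [MvPolynomial.eval_eq', Finset.sum_image fun d _ d' _ h => heinj h]
    refine Finset.sum_congr rfl fun d _ => ?_
    simp only [he, hsingle, Fin.prod_univ_two]
    ring
  · intro w
    rw [MvPolynomial.aeval_def, MvPolynomial.eval₂_eq', Finset.sum_image fun d _ d' _ h => heinj h]
    refine Finset.sum_congr rfl fun d _ => ?_
    simp only [he, hsingle, Fin.prod_univ_two, Complex.coe_algebraMap]
    ring

/-- **Step 2 of the paper proof of 23124 (`stub_planar`)**: `W(B₄)` + the half-reflection + full `p₀`-degree + Wick-hyperbolicity along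
`e₀` force invariance under the rotations of the 60° plane `span(e₀, (0,1,1,1)/√3)`.  Statement = the birth skeleton's `stub_planar` with its
definitions unfolded. [folklore] -/
theorem stub_planar :
    ∀ D₀ : MvPolynomial (Fin 4) ℝ,
      (∀ (σ : Equiv.Perm (Fin 4)) (ε : Fin 4 → ℝ), (∀ i, ε i = 1 ∨ ε i = -1) →
        ∀ p : Fin 4 → ℝ, MvPolynomial.eval (fun i => ε i * p (σ i)) D₀ = MvPolynomial.eval p D₀) →
      (∀ p : Fin 4 → ℝ, MvPolynomial.eval (fun i => p i - (∑ j, p j) / 2) D₀ = MvPolynomial.eval p D₀) →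
      MvPolynomial.coeff (Finsupp.single 0 D₀.totalDegree) D₀ ≠ 0 →
      (∀ q : Fin 4 → ℝ, (∑ i, q i * (fun i : Fin 4 => if i = 0 then (1 : ℝ) else 0) i) = 0 →
        ∀ z : ℂ, MvPolynomial.aeval (fun i => z * ((fun i : Fin 4 => if i = 0 then (1 : ℝ) else 0) i : ℂ) + (q i : ℂ)) D₀ = 0 →
          z.re = 0) →
      (∀ q : Fin 4 → ℝ, (∑ i, q i * (fun _ : Fin 4 => (1 : ℝ) / 2) i) = 0 →
        ∀ z : ℂ, MvPolynomial.aeval (fun i => z * ((fun _ : Fin 4 => (1 : ℝ) / 2) i : ℂ) + (q i : ℂ)) D₀ = 0 → z.re = 0) →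
      ∀ (φ : ℝ) (p : Fin 4 → ℝ), MvPolynomial.eval (fun i =>
        let a := p 0
        let b := (p 1 + p 2 + p 3) / Real.sqrt 3
        if i = 0 then Real.cos φ * a - Real.sin φ * b
        else p i + ((Real.sin φ * a + Real.cos φ * b) - b) / Real.sqrt 3) D₀ = MvPolynomial.eval p D₀ := by
  intro D hB4 hhalf hfull hWe0 _ 
  classical
  have hs0 : Real.sqrt 3 ≠ 0 := Real.sqrt_ne_zero'.2 (by norm_num)
  have hs : Real.sqrt 3 * Real.sqrt 3 = 3 := Real.mul_self_sqrt (by norm_num)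
  -- `N = deg D` is even (`D` is even in `p₀` and has the monomial `p₀^N`)
  set N : ℕ := D.totalDegree with hN
  have hflipD : ∀ ε : Fin 4 → ℝ, (∀ i, ε i = 1 ∨ ε i = -1) →
      ∀ p : Fin 4 → ℝ, MvPolynomial.eval (fun i => ε i * p i) D = MvPolynomial.eval p D :=
    fun ε hε p => by simpa using hB4 (Equiv.refl _) ε hε p
  obtain ⟨k, hk⟩ : ∃ k, N = 2 * k := by
    rcases Nat.even_or_odd N with h | h
    · obtain ⟨k, hk⟩ := h; exact ⟨k, by omega⟩
    · exfalso
      apply hfull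
      exact coeff_eq_zero_of_odd D hflipD (Finsupp.single 0 N) 0 (by simpa using h)
  -- the radial planar restrictions
  refine planeRotInv_of_planar_radial D fun q₀ _ hqs => ?_
  -- §A/B: the Chevalley polynomial of the restriction
  obtain ⟨cpoly, hcpoly⟩ := planar_restriction_dihedral D hB4 hhalf q₀ hqs
  obtain ⟨S, cf, hcf, hcfR, hcfC⟩ := exists_pairSum cpoly
  -- the restriction as a polynomial `b`
  set b : MvPolynomial (Fin 2) ℝ := MvPolynomial.bind₁ (fun i : Fin 4 => if i = 0 then (MvPolynomial.X 0 : MvPolynomial (Fin 2) ℝ)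
    else MvPolynomial.C (1 / Real.sqrt 3) * MvPolynomial.X 1 + MvPolynomial.C (q₀ i)) D with hb
  have hb_eval : ∀ v : Fin 2 → ℝ, MvPolynomial.eval v b =
      MvPolynomial.eval (fun i : Fin 4 => if i = 0 then v 0 else v 1 / Real.sqrt 3 + q₀ i) D := by
    intro v
    rw [hb, eval_planarRestriction]
    have hpt : (fun i : Fin 4 => if i = 0 then v 0 else 1 / Real.sqrt 3 * v 1 + q₀ i) =
        fun i : Fin 4 => if i = 0 then v 0 else v 1 / Real.sqrt 3 + q₀ i := by
      funext i; by_cases hi : i = 0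
      · simp only [hi, if_true]
      · simp only [hi, if_false]; ring
    rw [hpt]
  have hbS : ∀ v : Fin 2 → ℝ, MvPolynomial.eval v b =
      ∑ ij ∈ S, cf ij * (v 0 ^ 2 + v 1 ^ 2) ^ ij.1 * (3 * v 0 ^ 2 * v 1 - v 1 ^ 3) ^ ij.2 := by
    intro v
    rw [hb_eval, hcpoly (v 0) (v 1), hcfR]
    refine Finset.sum_congr rfl fun ij _ => ?_
    simp only [if_true, if_one_eq]
  have hbdeg : b.totalDegree ≤ 2 * k := by rw [← hk]; exact totalDegree_planarRestriction_le D _ q₀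
  -- invariances of `b` (even in `x`, rotation by 120°), inherited from `D`
  have hε0 : ∀ P : Fin 4 → ℝ, MvPolynomial.eval (fun i => if i = 0 then -P 0 else P i) D = MvPolynomial.eval P D := by
    intro P
    have h := hflipD (fun i => if i = 0 then -1 else 1) (fun i => by by_cases hi : i = 0 <;> simp [hi]) P
    have hpt : (fun i : Fin 4 => if i = 0 then -P 0 else P i) =
        fun i : Fin 4 => (if i = 0 then (-1 : ℝ) else 1) * P i := by
      funext i; by_cases hi : i = 0
      · simp [hi]
      · simp [hi]
    exact (congrArg (fun w => MvPolynomial.eval w D) hpt).trans h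
  have hbeven : ∀ v : Fin 2 → ℝ, MvPolynomial.eval (fun i => if i = 0 then -v 0 else v 1) b = MvPolynomial.eval v b := by
    intro v
    rw [hb_eval, hb_eval, if_pos rfl, if_neg (by decide : ¬ ((1 : Fin 2) = 0))]
    have hpt : (fun i : Fin 4 => if i = 0 then -v 0 else v 1 / Real.sqrt 3 + q₀ i) =
        fun i : Fin 4 => if i = 0 then -(fun j : Fin 4 => if j = 0 then v 0 else v 1 / Real.sqrt 3 + q₀ j) 0
          else (fun j : Fin 4 => if j = 0 then v 0 else v 1 / Real.sqrt 3 + q₀ j) i := by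
      funext i; by_cases hi : i = 0
      · simp [hi]
      · simp [hi]
    rw [hpt]
    exact hε0 _
  have hbrot : ∀ v : Fin 2 → ℝ, MvPolynomial.eval
      (fun i => if i = 0 then -(1/2 : ℝ) * v 0 - (Real.sqrt 3 / 2) * v 1
        else (Real.sqrt 3 / 2) * v 0 - (1/2 : ℝ) * v 1) b = MvPolynomial.eval v b := by
    intro v
    rw [hb_eval, hb_eval, if_pos rfl, if_neg (by decide : ¬ ((1 : Fin 2) = 0))]
    set w : Fin 4 → ℝ := fun i => if i = 0 then -v 0 else v 1 / Real.sqrt 3 + q₀ i with hw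
    have hw_eval : MvPolynomial.eval w D =
        MvPolynomial.eval (fun i : Fin 4 => if i = 0 then v 0 else v 1 / Real.sqrt 3 + q₀ i) D := by
      have hpt : w = fun i : Fin 4 => if i = 0 then -(fun j : Fin 4 => if j = 0 then v 0 else v 1 / Real.sqrt 3 + q₀ j) 0
          else (fun j : Fin 4 => if j = 0 then v 0 else v 1 / Real.sqrt 3 + q₀ j) i := by
        funext i; rw [hw]; by_cases hi : i = 0
        · simp [hi]
        · simp [hi]
      rw [hpt]; exact hε0 _
    have hsum : ∑ j, w j = -v 0 + Real.sqrt 3 * v 1 := by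
      rw [Fin.sum_univ_four, hw]
      simp only [if_true, show (1 : Fin 4) ≠ 0 by decide, show (2 : Fin 4) ≠ 0 by decide, show (3 : Fin 4) ≠ 0 by decide,
        if_false]
      field_simp
      linear_combination hqs * Real.sqrt 3 - v 1 * hs
    have hpt : (fun i : Fin 4 => if i = 0 then -(1/2 : ℝ) * v 0 - (Real.sqrt 3 / 2) * v 1
        else ((Real.sqrt 3 / 2) * v 0 - (1/2 : ℝ) * v 1) / Real.sqrt 3 + q₀ i) = fun i => w i - (∑ j, w j) / 2 := by
      funext i
      rw [hsum, hw]
      by_cases hi : i = 0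
      · simp only [hi, if_true]; ring
      · simp only [hi, if_false]
        field_simp
        linear_combination (v 1) * hs
    rw [hpt, hhalf w, hw_eval]
  -- §E: the top form via `mobiusTopForm`
  set T : MvPolynomial (Fin 2) ℝ := MvPolynomial.homogeneousComponent (2 * k) b with hT
  have hTcoeff : MvPolynomial.coeff (Finsupp.single 0 (2 * k)) T ≠ 0 := by
    rw [hT, MvPolynomial.coeff_homogeneousComponent, if_pos (by simp [Finsupp.degree_eq_sum]), ← hk, hb,
      coeff_top_planarRestriction D N le_rfl]
    exact hfull
  have hbcoeff : MvPolynomial.coeff (Finsupp.single 0 (2 * k)) b ≠ 0 := by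
    rw [← hk, hb, coeff_top_planarRestriction D N le_rfl]; exact hfull
  have hbW := planarRestriction_roots_imaginary D (1 / Real.sqrt 3) q₀ hWe0
  obtain ⟨c', hc'⟩ := mobiusTopForm k T (hT ▸ MvPolynomial.homogeneousComponent_isHomogeneous _ _) hTcoeff
    (hT ▸ topForm_roots_imaginary b (2 * k) hbdeg hbcoeff (hb ▸ hbW))
    (hT ▸ homogeneousComponent_rot b hbrot (2 * k))
  have hc'0 : c' ≠ 0 := by
    intro h0
    apply hTcoeff
    have : T = 0 := MvPolynomial.funext fun v => by rw [hc' v, h0, zero_mul, map_zero]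
    rw [this, MvPolynomial.coeff_zero]
  -- (DEG): the support of the Chevalley polynomial
  obtain ⟨hk0, hck0, hbound⟩ := support_bound_of_topForm S cf hcf b k hbdeg hbS c' hc'0 (fun v => by rw [← hT]; exact hc' v)
  -- §F: no `u₃`
  have hbpoly : b = ∑ ij ∈ S, MvPolynomial.C (cf ij) * (MvPolynomial.X 0 ^ 2 + MvPolynomial.X 1 ^ 2) ^ ij.1 *
      (MvPolynomial.C 3 * MvPolynomial.X 0 ^ 2 * MvPolynomial.X 1 - MvPolynomial.X 1 ^ 3) ^ ij.2 := by
    apply MvPolynomial.funext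
    intro v
    rw [hbS v, map_sum]
    refine Finset.sum_congr rfl fun ij _ => ?_
    simp only [map_mul, map_pow, map_add, map_sub, MvPolynomial.eval_C, MvPolynomial.eval_X]
  have hWQ : ∀ (y : ℝ) (vv : ℂ),
      (∑ ij ∈ S, (cf ij : ℂ) * vv ^ ij.1 * (3 * vv * (y : ℂ) - 4 * (y : ℂ) ^ 3) ^ ij.2) = 0 → vv.im = 0 := by
    intro y vv hvv
    obtain ⟨z, hz⟩ := IsAlgClosed.exists_pow_nat_eq (vv - (y : ℂ) ^ 2) (by norm_num : 0 < 2)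
    have hzb : MvPolynomial.aeval (fun i : Fin 2 => if i = 0 then z else (y : ℂ)) b = 0 := by
      rw [hbpoly, map_sum, ← hvv]
      refine Finset.sum_congr rfl fun ij _ => ?_
      simp only [map_mul, map_pow, map_add, map_sub, MvPolynomial.aeval_C, MvPolynomial.aeval_X, if_true, if_one_eq,
        Complex.coe_algebraMap]
      have h1 : z ^ 2 + (y : ℂ) ^ 2 = vv := by rw [hz]; ring
      have h2 : (3 : ℂ) * z ^ 2 * (y : ℂ) - (y : ℂ) ^ 3 = 3 * vv * (y : ℂ) - 4 * (y : ℂ) ^ 3 := by rw [hz]; ring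
      push_cast
      rw [h1, h2]
    have hzre : z.re = 0 := hbW y z hzb
    have : vv = z ^ 2 + (y : ℂ) ^ 2 := by rw [hz]; ring
    rw [this, Complex.add_im, ← Complex.ofReal_pow, Complex.ofReal_im, add_zero, pow_two, Complex.mul_im, hzre,
      zero_mul, mul_zero, add_zero]
  have hnoU3 := noU3Lemma k S cf hk0 (by rw [hck0]; exact hc'0) hbound hWQ
  have hj0 : ∀ ij ∈ S, ij.2 = 0 := by
    intro ij hij
    by_contra h
    exact hcf ij hij (hnoU3 ij hij (Nat.pos_of_ne_zero h))
  -- §G input: `b_{q₀} = F(x² + y²)`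
  refine ⟨∑ ij ∈ S, Polynomial.C (cf ij) * Polynomial.X ^ ij.1, fun x y => ?_⟩
  have h1 := hbS (fun i => if i = 0 then x else y)
  rw [hb_eval] at h1
  simp only [if_true, if_one_eq] at h1
  rw [h1, Polynomial.eval_finsetSum]
  refine Finset.sum_congr rfl fun ij hij => ?_
  rw [hj0 ij hij, pow_zero, mul_one, Polynomial.eval_mul, Polynomial.eval_C, Polynomial.eval_pow, Polynomial.eval_X]

end Summit.QuantumFields.YangMills.Theorems.RationalShortRootRigidity
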